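import Summits.BirchSwinnertonDyer.Rank1Residual.O5.CongruenceBlockTwist
import HarnessLib

/-!
# O5 pool: BLOCK-TWIN, sibling — the twist commutes with the degeneracy maps
# (`R(ι_d F) = χ(d) ι_d(F ⊗ χ)`), the `p`-depletion identity, and the old-space pair `V_F ↔ V_{F⊗χ}`

HONEST FRAMING (cell `b2b-bsdres`, run/shared/lean/b2b/bsd-rank1-residual/, verbatim in every
file): the goal of the cell is to DELETE the COMBINATION-SHAPED residual classes of the
Birch–Swinnerton-Dyer formula for ALL analytic-rank `≤ 1` elliptic curves over `ℚ` — assembled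
STRICTLY from published theorems — so that the rank-`≤ 1` remainder becomes exactly the
CONSTRUCTION-SHAPED classes, which are TYPED, NOT attempted. This is not "finishing BSD". Lane
CLASS-CLOSURE, team o5 (planner o5-r2 GEN 7, `gen7/TWIN-PROOF.md` Addendum "BLOCK TWIN", the
paragraph *Instances at p = 3, N = 9M′*; `gen7/BLOCKS-SCHEMA.md` T-F2 = EVIDENCE, not an input);
prover seat `b2b-bsdres-x11b3-p5` GEN 12 (cross-cell pool item P5-BT, second file of one target,
400-line cap). THEOREMS ONLY (no definition, no named fact, no `sorry`); nothing booked; no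
RESIDUAL-MAP mark / label / count moved; every O5 conjecture node UNTOUCHED and NOT discharged;
no congruence block is DEFINED — old spaces appear as explicit spans of degeneracy images.

## What

`R = charTwist N dvd_rfl hpN hχ` is the twist by the primitive quadratic character `χ` mod `p`
on `S_k(Γ₀(N))`, `p² ∣ N` (as in `O5/CongruenceBlockTwist.lean`); `ι_d : S_k(Γ₀(M)) → S_k(Γ₀(N))`,
`(ι_d F)(τ) = F(dτ)`, is the tree's degeneracy map `iota M N d k _` (`M d ∣ N`); `R′` denotes the
twist from level `M` to a level `M′` with `M ∣ M′`, `p² ∣ M′` (`charTwist M′ _ _ hχ`).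

* §1 `charTwist_iota`: **`R(ι_d F) = χ(d) • ι_d(R′F)`** whenever `M d ∣ N`, `M′ d ∣ N` (both
  sides are `∑ χ(dn) aₙ(F) q^{dn}`); `charTwist_iota_eq_zero`: `R(ι_d F) = 0` for `p ∣ d`;
  `iota_iota`: `ι_d (ι_e F) = ι_{de} F`.
* §2 `p`-DEPLETION of a NEWFORM `F` of level `M` as degeneracy images at a level `M′`
  (`IsNewform0.cuspCoeff_prime_mul`): `charTwist_charTwist_eq_depletion` (`p ∤ M`, `M p² ∣ M′`):
  **`R″(R′F) = ι₁ F − a_p • ι_p F + p^{k-1} • ι_{p²} F`** (planner's `F⁽³⁾ = F − a₃F(3z) + 3F(9z)`);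
  `…_of_dvd` (`p ∣ M`, `M p ∣ M′`): `R″(R′F) = ι₁ F − a_p • ι_p F` (`F⁽³⁾ = F − a₃F(3z)`).
* §3 OLD-SPACE PAIRS: `charTwist_mem_span_iota_twist_level` — `R(span{ι_d F : M d ∣ N}) ⊆
  span{ι_d(R′F) : M′ d ∣ N}` for any `F` and any twist level `M′` reachable off `p` (instances
  `…_twist`: `p ∤ M`, `M′ = p²M` = `R_χ(B0) ⊂ ω̃BT`; `p ∥ M`, `M′ = pM` = `R_χ(B1) ⊂ ω̃St`), and the
  reverse inclusions for NEWFORMS `charTwist_mem_span_iota_of_twist` (`p ∤ M`: `R_χ(ω̃BT) ⊂ B0`) /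
  `…_of_dvd` (`p ∣ M`: `R_χ(ω̃St) ⊂ B1`) — the hypotheses of
  `PrimeTwist.natCard_blockQuotient_charTwist` for `(X, X′) = (V_F, V_{F ⊗ χ})` on `F`-isotypic parts
  (several `F`: unions of spanning sets, `PrimeTwist.charTwist_mem_of_mem_span`); the span-pair
  form `natCard_blockQuotient_charTwist_span`, its instance `…_span_image` for `(span T, span R(T))`,
  `T` any set of `p`-depleted forms (the `SC ⊖ f ↔ SC ⊖ f^χ` shape), and `…_of_isNewform0`.

Not claimed: that these spans ARE the Atkin–Lehner old spaces of the eigen-decomposition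
([AtkinLehner1970] Thm. 5; Atkin–Li = the tree's `isNewform0_charTwist_of_isPrimePow_of_coprime`;
not needed for the inclusions), Hecke-stability, the exact level of a Steinberg twist, which
newforms are `p`-primitive (`SC`), any block definition. References: [Shimura1971] Prop. 3.64;
[AtkinLehner1970] §2, Thm. 3; [DiamondShurman2005] §5.7, Prop. 5.8.5; [AgasheRibetStein2012] §2.1;
cell files `HOME/b2b-bsdres-o5-r2/gen7/TWIN-PROOF.md` (Addendum), `gen7/BLOCKS-SCHEMA.md`.
-/

noncomputable section

open scoped MatrixGroups ModularForm

open CongruenceSubgroup Literature.NumberTheory.EllipticCurves.ModularForms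

namespace Summit.BirchSwinnertonDyer.Rank1Residual.O5

namespace PrimeTwist

variable {N p : ℕ} [NeZero N] [hp : Fact p.Prime] {k : ℤ} (hpN : p ^ 2 ∣ N)
  {χ : DirichletCharacter ℂ p} (hχ : χ.IsQuadratic)

/-! ### §1 The twist commutes with the degeneracy maps up to `χ(d)` -/

/-- **`R(ι_d F) = χ(d) • ι_d(R′F)`**: twisting `F(dτ)` by `χ` at level `N` gives `χ(d)` times the
`d`-th degeneracy image of the twist `R′F` of `F` (taken at any level `M′` with `M ∣ M′`,
`p² ∣ M′`, `M′ d ∣ N`). Both sides have `q`-expansion `∑ₙ χ(d n) aₙ(F) q^{dn}`; for `p ∣ d` both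
vanish (`χ(d) = 0`). This is the planner's `R_χ(F(dz)) = χ(d) F^χ(dz)`.
[cite: Shimura1971, Prop. 3.64] [cite: DiamondShurman2005, §5.7] -/
theorem charTwist_iota (hprim : χ.IsPrimitive) {M M' d : ℕ} [NeZero M] [NeZero M'] [NeZero d]
    (hMd : M * d ∣ N) (hM'd : M' * d ∣ N) (hMM' : M ∣ M') (hpM' : p ^ 2 ∣ M')
    (F : CuspForm (Gamma0 M) k) :
    charTwist N dvd_rfl hpN hχ (iota M N d k hMd F) =
      χ d • iota M' N d k hM'd (charTwist M' hMM' hpM' hχ F) := by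
  refine eq_of_forall_cuspCoeff_eq_gamma0 fun n ↦ ?_
  rw [cuspCoeff_charTwist N _ hpN hχ hprim, cuspCoeff_smul]
  have h2 : ∀ m, cuspCoeff (charTwist M' hMM' hpM' hχ F) m = χ m * cuspCoeff F m :=
    fun m ↦ cuspCoeff_charTwist M' _ hpM' hχ hprim F m
  simp only [cuspCoeff] at h2 ⊢
  rw [qExpansion_coeff_iota, qExpansion_coeff_iota]
  by_cases hdn : d ∣ n
  · obtain ⟨m, rfl⟩ := hdn
    have hd : 0 < d := NeZero.pos d
    rw [if_pos (dvd_mul_right d m), if_pos (dvd_mul_right d m), Nat.mul_div_cancel_left m hd, h2,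
      Nat.cast_mul, map_mul]
    ring
  · rw [if_neg hdn, if_neg hdn, mul_zero, mul_zero]

/-- **`R(ι_d F) = 0` for `p ∣ d`**: all coefficients of `F(dτ)` sit in degrees divisible by `p`,
where `χ` vanishes (the planner's `R_χ(F(3z)) = R_χ(F(9z)) = 0`). [cite: Shimura1971, Prop. 3.64] -/
theorem charTwist_iota_eq_zero (hprim : χ.IsPrimitive) {M d : ℕ} [NeZero M] [NeZero d]
    (hMd : M * d ∣ N) (hpd : p ∣ d) (F : CuspForm (Gamma0 M) k) :
    charTwist N dvd_rfl hpN hχ (iota M N d k hMd F) = 0 := by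
  refine eq_of_forall_cuspCoeff_eq_gamma0 fun n ↦ ?_
  rw [cuspCoeff_charTwist N _ hpN hχ hprim, cuspCoeff_zero_form (one_mem_strictPeriods_coe_gamma0 N)]
  simp only [cuspCoeff]
  rw [qExpansion_coeff_iota]
  by_cases hdn : d ∣ n
  · rw [chi_natCast_eq_zero χ (hpd.trans hdn), zero_mul]
  · rw [if_neg hdn, mul_zero]

omit [NeZero N] in
/-- `ι_d (ι_e F) = ι_{d e} F` (`F(e(dτ)) = F((de)τ)`; on `q`-expansions). [cite: DiamondShurman2005, §5.7] -/
theorem iota_iota {M M' d e : ℕ} [NeZero M] [NeZero M'] [NeZero d] [NeZero e]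
    (hMe : M * e ∣ M') (hM'd : M' * d ∣ N) (hMde : M * (d * e) ∣ N) (F : CuspForm (Gamma0 M) k) :
    haveI : NeZero (d * e) := ⟨mul_ne_zero (NeZero.ne d) (NeZero.ne e)⟩
    iota M' N d k hM'd (iota M M' e k hMe F) = iota M N (d * e) k hMde F := by
  haveI : NeZero (d * e) := ⟨mul_ne_zero (NeZero.ne d) (NeZero.ne e)⟩
  refine eq_of_forall_cuspCoeff_eq_gamma0 fun n ↦ ?_
  simp only [cuspCoeff]
  rw [qExpansion_coeff_iota, qExpansion_coeff_iota]
  by_cases hdn : d ∣ n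
  · obtain ⟨m, rfl⟩ := hdn
    rw [if_pos (dvd_mul_right d m), Nat.mul_div_cancel_left m (NeZero.pos d), qExpansion_coeff_iota]
    by_cases hem : e ∣ m
    · obtain ⟨r, rfl⟩ := hem
      rw [if_pos (dvd_mul_right e r), if_pos (mul_dvd_mul_left d (dvd_mul_right e r)),
        Nat.mul_div_cancel_left r (NeZero.pos e), ← mul_assoc,
        Nat.mul_div_cancel_left r (mul_pos (NeZero.pos d) (NeZero.pos e))]
    · rw [if_neg hem, if_neg]
      rintro ⟨r, hr⟩
      exact hem ⟨r, Nat.eq_of_mul_eq_mul_left (NeZero.pos d) (by rw [hr, mul_assoc])⟩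
  · rw [if_neg hdn, qExpansion_coeff_iota, if_neg]
    exact fun h ↦ hdn ((dvd_mul_right d e).trans h)

/-! ### §2 The `p`-depletion identity for a newform of level prime to `p` -/

/-- **`p`-depletion of a newform as a combination of degeneracy images**: for a newform `F` of
level `M` with `p ∤ M` and a level `M′` with `M p² ∣ M′` (and `p² ∣ M′`, `M ∣ M′`),
`R″(R′F) = ι₁ F − a_p(F) • ι_p F + p^{k-1} • ι_{p²} F` in `S_k(Γ₀(M′))`, where `R′F` is the twist of
`F` to level `M′` and `R″` the twist at level `M′`: the left side is `∑_{p ∤ n} aₙ(F) qⁿ`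
(`χ(n)² = 𝟙_{p ∤ n}`), and the coefficient of `q^{pm}` on the right vanishes by the Hecke recursion
`a_{pm} = a_p a_m − p^{k-1} a_{m/p}` (`IsNewform0.cuspCoeff_prime_mul`, `p ∤ M`). Planner's
`F⁽³⁾ = F − a₃ F(3z) + 3 F(9z)` (weight `2`, `p = 3`). [cite: AtkinLehner1970, Thm. 3]
[cite: DiamondShurman2005, Prop. 5.8.5] -/
theorem charTwist_charTwist_eq_depletion (hprim : χ.IsPrimitive) {M M' : ℕ} [NeZero M] [NeZero M']
    (hpM : ¬ p ∣ M) (hMM' : M ∣ M') (hpM' : p ^ 2 ∣ M') (h1 : M * 1 ∣ M') (hp1 : M * p ∣ M')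
    (hp2 : M * (p ^ 2) ∣ M') {F : CuspForm (Gamma0 M) k} (hF : IsNewform0 F) :
    haveI : NeZero (p ^ 2) := ⟨pow_ne_zero 2 hp.out.ne_zero⟩
    charTwist M' dvd_rfl hpM' hχ (charTwist M' hMM' hpM' hχ F) =
      iota M M' 1 k h1 F - cuspCoeff F p • iota M M' p k hp1 F +
        ((p : ℂ) ^ (k - 1)) • iota M M' (p ^ 2) k hp2 F := by
  haveI : NeZero (p ^ 2) := ⟨pow_ne_zero 2 hp.out.ne_zero⟩
  haveI : NeZero p := ⟨hp.out.ne_zero⟩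
  refine eq_of_forall_cuspCoeff_eq_gamma0 fun n ↦ ?_
  rw [cuspCoeff_charTwist M' _ hpM' hχ hprim, cuspCoeff_charTwist M' _ hpM' hχ hprim, ← mul_assoc,
    ← sq, cuspCoeff_add_form (one_mem_strictPeriods_coe_gamma0 M'),
    sub_eq_add_neg, cuspCoeff_add_form (one_mem_strictPeriods_coe_gamma0 M'), ← neg_smul,
    cuspCoeff_smul, cuspCoeff_smul]
  simp only [cuspCoeff]
  rw [qExpansion_coeff_iota, qExpansion_coeff_iota, qExpansion_coeff_iota, if_pos (one_dvd n),
    Nat.div_one]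
  by_cases hpn : p ∣ n
  · -- degree `n = p m`: `χ(n) = 0` and the Hecke recursion kills the right side
    obtain ⟨m, rfl⟩ := hpn
    rw [chi_natCast_eq_zero χ (dvd_mul_right p m), zero_pow two_ne_zero, zero_mul,
      if_pos (dvd_mul_right p m), Nat.mul_div_cancel_left m hp.out.pos]
    have hrec := hF.cuspCoeff_prime_mul hp.out m
    simp only [cuspCoeff, if_neg hpM] at hrec
    rw [hrec]
    by_cases hpm : p ∣ m
    · obtain ⟨r, rfl⟩ := hpm
      rw [if_pos (dvd_mul_right p r), Nat.mul_div_cancel_left r hp.out.pos, if_pos ⟨r, by ring⟩,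
        show p * (p * r) / p ^ 2 = r by
          rw [← mul_assoc, ← sq, Nat.mul_div_cancel_left r (pow_pos hp.out.pos 2)]]
      ring
    · rw [if_neg hpm, if_neg]
      · ring
      · rintro ⟨r, hr⟩
        refine hpm ⟨r, Nat.eq_of_mul_eq_mul_left hp.out.pos ?_⟩
        rw [hr, sq, mul_assoc]
  · -- degree prime to `p`: `χ(n)² = 1`, the `ι_p`, `ι_{p²}` terms vanish
    rw [chi_natCast_sq hχ hpn, one_mul, if_neg hpn, if_neg fun h ↦ hpn ((dvd_pow_self p two_ne_zero).trans h)]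
    ring

/-! ### §3 The old-space pair `V_F ↔ V_{F ⊗ χ}` of a newform of level prime to `p` -/

/-- **`R(V_F) ⊆ V_{F ⊗ χ}`, general level**: for `F` of level `M` and a level `M′` of the twist
`R′F` (`M ∣ M′`, `p² ∣ M′`) such that `M′ d ∣ N` whenever `M d ∣ N` and `p ∤ d`, the twist maps
`span{ι_d F : M d ∣ N}` into `span{ι_d(R′F) : M′ d ∣ N}`: `R(ι_d F) = χ(d) ι_d(R′F)` for `p ∤ d`
and `= 0` for `p ∣ d`. Covers the planner's `R_χ(B0) ⊂ ω̃BT` (`p ∤ M`, `M′ = p²M`, see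
`charTwist_mem_span_iota_twist`) and `R_χ(B1) ⊂ ω̃St` (`p ∥ M`, `M′ = pM`). No newform hypothesis.
[cite: Shimura1971, Prop. 3.64] [cite: AtkinLehner1970, §2] -/
theorem charTwist_mem_span_iota_twist_level (hprim : χ.IsPrimitive) {M M' : ℕ} [NeZero M]
    [NeZero M'] (hMM' : M ∣ M') (hpM' : p ^ 2 ∣ M')
    (hlev : ∀ d : ℕ, M * d ∣ N → ¬ p ∣ d → M' * d ∣ N) (F : CuspForm (Gamma0 M) k)
    {x : CuspForm (Gamma0 N) k}
    (hx : x ∈ Submodule.span ℂ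
      {v | ∃ (d : ℕ) (_ : NeZero d) (h : M * d ∣ N), v = iota M N d k h F}) :
    charTwist N dvd_rfl hpN hχ x ∈ Submodule.span ℂ
      {v | ∃ (d : ℕ) (_ : NeZero d) (h : M' * d ∣ N),
        v = iota M' N d k h (charTwist M' hMM' hpM' hχ F)} := by
  refine charTwist_mem_of_mem_span hpN hχ hprim (fun t ht ↦ ?_) hx
  obtain ⟨d, hd, hMd, rfl⟩ := ht
  by_cases hpd : p ∣ d
  · rw [charTwist_iota_eq_zero hpN hχ hprim hMd hpd]
    exact Submodule.zero_mem _
  · rw [charTwist_iota hpN hχ hprim hMd (hlev d hMd hpd) hMM' hpM']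
    exact Submodule.smul_mem _ _ (Submodule.subset_span ⟨d, hd, hlev d hMd hpd, rfl⟩)

/-- **`R(V_F) ⊆ V_{F ⊗ χ}`** (the planner's `R_χ(B0) ⊂ ω̃BT` on the `F`-part): for `F` of level `M`
(`p ∤ M`), the twist maps the span of the degeneracy images `ι_d F` (`M d ∣ N`) into the
span of the images `ι_d(R′F)` (`p² M d ∣ N`) of the twist `R′F` at level `p² M`
(`p ∤ d`, `M d ∣ N`, `p² ∣ N`, `p ∤ M` ⟹ `p² M d ∣ N`). No newform hypothesis.
[cite: Shimura1971, Prop. 3.64] [cite: AtkinLehner1970, §2] -/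
theorem charTwist_mem_span_iota_twist (hprim : χ.IsPrimitive) {M : ℕ} [NeZero M]
    (hpM : ¬ p ∣ M) (F : CuspForm (Gamma0 M) k)
    {x : CuspForm (Gamma0 N) k}
    (hx : x ∈ Submodule.span ℂ
      {v | ∃ (d : ℕ) (_ : NeZero d) (h : M * d ∣ N), v = iota M N d k h F}) :
    haveI : NeZero (p ^ 2 * M) := ⟨mul_ne_zero (pow_ne_zero 2 hp.out.ne_zero) (NeZero.ne M)⟩
    charTwist N dvd_rfl hpN hχ x ∈ Submodule.span ℂ
      {v | ∃ (d : ℕ) (_ : NeZero d) (h : p ^ 2 * M * d ∣ N),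
        v = iota (p ^ 2 * M) N d k h
          (charTwist (p ^ 2 * M) (dvd_mul_left M (p ^ 2)) (dvd_mul_right (p ^ 2) M) hχ F)} := by
  haveI : NeZero (p ^ 2 * M) := ⟨mul_ne_zero (pow_ne_zero 2 hp.out.ne_zero) (NeZero.ne M)⟩
  refine charTwist_mem_span_iota_twist_level hpN hχ hprim _ _ (fun d hMd hpd ↦ ?_) F hx
  have hcop : (p ^ 2).Coprime (M * d) :=
    Nat.Coprime.pow_left 2 ((Nat.Prime.coprime_iff_not_dvd hp.out).mpr
      (fun h ↦ (hp.out.dvd_mul.mp h).elim hpM hpd))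
  rw [mul_assoc]
  exact hcop.mul_dvd_of_dvd_of_dvd hpN hMd

/-- **`R(V_{F ⊗ χ}) ⊆ V_F`** (the planner's `R_χ(ω̃BT) ⊂ B0` on the `F`-part): for a NEWFORM `F`
of level `M`, `p ∤ M`: `R(ι_d(R′F)) = χ(d) ι_d(R″R′F)` and
`R″R′F = ι₁F − a_p ι_p F + p^{k-1} ι_{p²} F` (`charTwist_charTwist_eq_depletion`), so
`R(ι_d(R′F)) = χ(d)(ι_d F − a_p ι_{dp} F + p^{k-1} ι_{dp²} F) ∈ span{ι_e F : M e ∣ N}`.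
[cite: Shimura1971, Prop. 3.64] [cite: AtkinLehner1970, Thm. 3] -/
theorem charTwist_mem_span_iota_of_twist (hprim : χ.IsPrimitive) {M : ℕ} [NeZero M]
    (hpM : ¬ p ∣ M) {F : CuspForm (Gamma0 M) k} (hF : IsNewform0 F)
    {x : CuspForm (Gamma0 N) k}
    (hx : haveI : NeZero (p ^ 2 * M) := ⟨mul_ne_zero (pow_ne_zero 2 hp.out.ne_zero) (NeZero.ne M)⟩
      x ∈ Submodule.span ℂ
        {v | ∃ (d : ℕ) (_ : NeZero d) (h : p ^ 2 * M * d ∣ N),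
          v = iota (p ^ 2 * M) N d k h
            (charTwist (p ^ 2 * M) (dvd_mul_left M (p ^ 2)) (dvd_mul_right (p ^ 2) M) hχ F)}) :
    charTwist N dvd_rfl hpN hχ x ∈ Submodule.span ℂ
      {v | ∃ (d : ℕ) (_ : NeZero d) (h : M * d ∣ N), v = iota M N d k h F} := by
  haveI : NeZero (p ^ 2 * M) := ⟨mul_ne_zero (pow_ne_zero 2 hp.out.ne_zero) (NeZero.ne M)⟩
  haveI : NeZero (p ^ 2) := ⟨pow_ne_zero 2 hp.out.ne_zero⟩
  haveI : NeZero p := ⟨hp.out.ne_zero⟩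
  refine charTwist_mem_of_mem_span hpN hχ hprim (fun t ht ↦ ?_) hx
  obtain ⟨d, hd, hM'd, rfl⟩ := ht
  have hpM' : p ^ 2 ∣ p ^ 2 * M := dvd_mul_right (p ^ 2) M
  have hMM' : M ∣ p ^ 2 * M := dvd_mul_left M (p ^ 2)
  -- twist at the same level `p² M`, then the depletion identity
  rw [charTwist_iota hpN hχ hprim hM'd hM'd dvd_rfl hpM',
    charTwist_charTwist_eq_depletion hχ hprim hpM hMM' hpM' (by simp)
      (by rw [mul_comm]; exact mul_dvd_mul_right (dvd_pow_self p two_ne_zero) M)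
      (by rw [mul_comm]) hF]
  have hMd : M * d ∣ N := (mul_dvd_mul_right hMM' d).trans hM'd
  have hMdp : M * (d * p) ∣ N := by
    have : M * (d * p) ∣ p ^ 2 * M * d := ⟨p, by ring⟩
    exact this.trans hM'd
  have hMdp2 : M * (d * p ^ 2) ∣ N := by
    have : M * (d * p ^ 2) = p ^ 2 * M * d := by ring
    rw [this]; exact hM'd
  rw [map_add, map_sub, map_smul, map_smul,
    iota_iota (by simp) hM'd (by simpa using hMd),
    iota_iota (by rw [mul_comm]; exact mul_dvd_mul_right (dvd_pow_self p two_ne_zero) M) hM'd hMdp,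
    iota_iota (by rw [mul_comm]) hM'd hMdp2]
  refine Submodule.smul_mem _ _ (Submodule.add_mem _ (Submodule.sub_mem _ ?_ ?_) ?_)
  · haveI : NeZero (d * 1) := ⟨by simpa using NeZero.ne d⟩
    exact Submodule.subset_span ⟨d * 1, inferInstance, by simpa using hMd, rfl⟩
  · haveI : NeZero (d * p) := ⟨mul_ne_zero (NeZero.ne d) hp.out.ne_zero⟩
    exact Submodule.smul_mem _ _ (Submodule.subset_span ⟨d * p, inferInstance, hMdp, rfl⟩)
  · haveI : NeZero (d * p ^ 2) := ⟨mul_ne_zero (NeZero.ne d) (pow_ne_zero 2 hp.out.ne_zero)⟩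
    exact Submodule.smul_mem _ _ (Submodule.subset_span ⟨d * p ^ 2, inferInstance, hMdp2, rfl⟩)

/-- **`p`-depletion of a newform of level divisible by `p`**: for a newform `F` of level `M` with
`p ∣ M` (so `a_{pm} = a_p a_m`, [AtkinLehner1970] Thm. 3) and a level `M′` with `M p ∣ M′`
(`p² ∣ M′`, `M ∣ M′`): `R″(R′F) = ι₁ F − a_p(F) • ι_p F` — the planner's "`F⁽³⁾ = F − a₃F(3z)` for
`F` of `3`-level `3`". [cite: AtkinLehner1970, Thm. 3] [cite: DiamondShurman2005, Prop. 5.8.5] -/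
theorem charTwist_charTwist_eq_depletion_of_dvd (hprim : χ.IsPrimitive) {M M' : ℕ} [NeZero M]
    [NeZero M'] (hpM : p ∣ M) (hMM' : M ∣ M') (hpM' : p ^ 2 ∣ M') (h1 : M * 1 ∣ M')
    (hp1 : M * p ∣ M') {F : CuspForm (Gamma0 M) k} (hF : IsNewform0 F) :
    haveI : NeZero p := ⟨hp.out.ne_zero⟩
    charTwist M' dvd_rfl hpM' hχ (charTwist M' hMM' hpM' hχ F) =
      iota M M' 1 k h1 F - cuspCoeff F p • iota M M' p k hp1 F := by
  haveI : NeZero p := ⟨hp.out.ne_zero⟩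
  refine eq_of_forall_cuspCoeff_eq_gamma0 fun n ↦ ?_
  rw [cuspCoeff_charTwist M' _ hpM' hχ hprim, cuspCoeff_charTwist M' _ hpM' hχ hprim, ← mul_assoc,
    ← sq, sub_eq_add_neg, cuspCoeff_add_form (one_mem_strictPeriods_coe_gamma0 M'), ← neg_smul,
    cuspCoeff_smul]
  simp only [cuspCoeff]
  rw [qExpansion_coeff_iota, qExpansion_coeff_iota, if_pos (one_dvd n), Nat.div_one]
  by_cases hpn : p ∣ n
  · obtain ⟨m, rfl⟩ := hpn
    rw [chi_natCast_eq_zero χ (dvd_mul_right p m), zero_pow two_ne_zero, zero_mul,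
      if_pos (dvd_mul_right p m), Nat.mul_div_cancel_left m hp.out.pos]
    have hrec := hF.cuspCoeff_prime_mul hp.out m
    simp only [cuspCoeff, if_pos hpM, sub_zero] at hrec
    rw [hrec]
    ring
  · rw [chi_natCast_sq hχ hpn, one_mul, if_neg hpn]
    ring

/-- **`R(V_{F ⊗ χ}) ⊆ V_F` for a newform of level divisible by `p`** (the planner's
`R_χ(ω̃St) ⊂ B1` on the `F`-part): `F` a newform of level `M`, `p ∣ M`, `R′F` its twist at a level
`M′` with `M p ∣ M′`, `p² ∣ M′`; then `R(ι_d(R′F)) = χ(d)(ι_d F − a_p ι_{dp} F) ∈ span{ι_e F : M e ∣ N}`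
for every `d` with `M′ d ∣ N`. [cite: Shimura1971, Prop. 3.64] [cite: AtkinLehner1970, Thm. 3] -/
theorem charTwist_mem_span_iota_of_twist_of_dvd (hprim : χ.IsPrimitive) {M M' : ℕ} [NeZero M]
    [NeZero M'] (hpM : p ∣ M) (hMM' : M ∣ M') (hpM' : p ^ 2 ∣ M') (hp1 : M * p ∣ M')
    {F : CuspForm (Gamma0 M) k} (hF : IsNewform0 F) {x : CuspForm (Gamma0 N) k}
    (hx : x ∈ Submodule.span ℂ
        {v | ∃ (d : ℕ) (_ : NeZero d) (h : M' * d ∣ N),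
          v = iota M' N d k h (charTwist M' hMM' hpM' hχ F)}) :
    charTwist N dvd_rfl hpN hχ x ∈ Submodule.span ℂ
      {v | ∃ (d : ℕ) (_ : NeZero d) (h : M * d ∣ N), v = iota M N d k h F} := by
  haveI : NeZero p := ⟨hp.out.ne_zero⟩
  refine charTwist_mem_of_mem_span hpN hχ hprim (fun t ht ↦ ?_) hx
  obtain ⟨d, hd, hM'd, rfl⟩ := ht
  have h1 : M * 1 ∣ M' := by simpa using hMM'
  rw [charTwist_iota hpN hχ hprim hM'd hM'd dvd_rfl hpM',
    charTwist_charTwist_eq_depletion_of_dvd hχ hprim hpM hMM' hpM' h1 hp1 hF]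
  have hMd : M * d ∣ N := (mul_dvd_mul_right hMM' d).trans hM'd
  have hMdp : M * (d * p) ∣ N := by
    have : M * (d * p) ∣ M' * d := by rw [mul_comm d p, ← mul_assoc]; exact mul_dvd_mul_right hp1 d
    exact this.trans hM'd
  rw [map_sub, map_smul, iota_iota h1 hM'd (by simpa using hMd), iota_iota hp1 hM'd hMdp]
  refine Submodule.smul_mem _ _ (Submodule.sub_mem _ ?_ ?_)
  · haveI : NeZero (d * 1) := ⟨by simpa using NeZero.ne d⟩
    exact Submodule.subset_span ⟨d * 1, inferInstance, by simpa using hMd, rfl⟩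
  · haveI : NeZero (d * p) := ⟨mul_ne_zero (NeZero.ne d) hp.out.ne_zero⟩
    exact Submodule.smul_mem _ _ (Submodule.subset_span ⟨d * p, inferInstance, hMdp, rfl⟩)

/-- **BLOCK-TWIN for a pair of spans**: `X = span T`, `X′ = span T′` with `R(T) ⊆ span T′` and
`R(T′) ⊆ span T`, `f` `p`-depleted — the form in which T-F2's pairs are instances.
[cite: AgasheRibetStein2012, §2.1] [cite: Shimura1971, Prop. 3.64] -/
theorem natCard_blockQuotient_charTwist_span (hprim : χ.IsPrimitive) {f : CuspForm (Gamma0 N) k}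
    (hf : ∀ n, p ∣ n → cuspCoeff f n = 0) {T T' : Set (CuspForm (Gamma0 N) k)}
    (hT : ∀ t ∈ T, charTwist N dvd_rfl hpN hχ t ∈ Submodule.span ℂ T')
    (hT' : ∀ t ∈ T', charTwist N dvd_rfl hpN hχ t ∈ Submodule.span ℂ T) :
    Nat.card (↥(integralCuspForms0 N k ⊓ ((ℂ ∙ f) ⊔ Submodule.span ℂ T).restrictScalars ℤ) ⧸
        ((ℤ ∙ f) ⊔ (integralCuspForms0 N k ⊓ (Submodule.span ℂ T).restrictScalars ℤ)).comap
          (integralCuspForms0 N k ⊓ ((ℂ ∙ f) ⊔ Submodule.span ℂ T).restrictScalars ℤ).subtype) =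
      Nat.card (↥(integralCuspForms0 N k ⊓
            ((ℂ ∙ charTwist N dvd_rfl hpN hχ f) ⊔ Submodule.span ℂ T').restrictScalars ℤ) ⧸
        ((ℤ ∙ charTwist N dvd_rfl hpN hχ f) ⊔
            (integralCuspForms0 N k ⊓ (Submodule.span ℂ T').restrictScalars ℤ)).comap
          (integralCuspForms0 N k ⊓
            ((ℂ ∙ charTwist N dvd_rfl hpN hχ f) ⊔ Submodule.span ℂ T').restrictScalars ℤ).subtype) :=
  natCard_blockQuotient_charTwist hpN hχ hprim hf
    (fun _ hx ↦ charTwist_mem_of_mem_span hpN hχ hprim hT hx)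
    (fun _ hx ↦ charTwist_mem_of_mem_span hpN hχ hprim hT' hx)

/-- **BLOCK-TWIN for a set of `p`-depleted forms and its twist** (the shape of the planner's
`SC ⊖ f ↔ SC ⊖ f^χ` column, where `R` permutes the `p`-primitive newforms): for ANY set `T` of
`p`-depleted forms, `X = span T` and `X′ = span R(T)` are exchanged by `R` (`R(Rt) = t`), so
`natCard_blockQuotient_charTwist` applies to `(f, span T)` and `(Rf, span R(T))` for every
`p`-depleted `f`. Which newforms are `p`-primitive (twist-stable level) is the reader's input.
[cite: AgasheRibetStein2012, §2.1] [cite: Shimura1971, Prop. 3.64] -/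
theorem natCard_blockQuotient_charTwist_span_image (hprim : χ.IsPrimitive)
    {f : CuspForm (Gamma0 N) k} (hf : ∀ n, p ∣ n → cuspCoeff f n = 0)
    {T : Set (CuspForm (Gamma0 N) k)} (hT : ∀ t ∈ T, ∀ n, p ∣ n → cuspCoeff t n = 0) :
    Nat.card (↥(integralCuspForms0 N k ⊓ ((ℂ ∙ f) ⊔ Submodule.span ℂ T).restrictScalars ℤ) ⧸
        ((ℤ ∙ f) ⊔ (integralCuspForms0 N k ⊓ (Submodule.span ℂ T).restrictScalars ℤ)).comap
          (integralCuspForms0 N k ⊓ ((ℂ ∙ f) ⊔ Submodule.span ℂ T).restrictScalars ℤ).subtype) =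
      Nat.card (↥(integralCuspForms0 N k ⊓ ((ℂ ∙ charTwist N dvd_rfl hpN hχ f) ⊔
            Submodule.span ℂ (charTwist N dvd_rfl hpN hχ '' T)).restrictScalars ℤ) ⧸
        ((ℤ ∙ charTwist N dvd_rfl hpN hχ f) ⊔ (integralCuspForms0 N k ⊓
            (Submodule.span ℂ (charTwist N dvd_rfl hpN hχ '' T)).restrictScalars ℤ)).comap
          (integralCuspForms0 N k ⊓ ((ℂ ∙ charTwist N dvd_rfl hpN hχ f) ⊔
            Submodule.span ℂ (charTwist N dvd_rfl hpN hχ '' T)).restrictScalars ℤ).subtype) :=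
  natCard_blockQuotient_charTwist_span hpN hχ hprim hf
    (fun t ht ↦ Submodule.subset_span ⟨t, ht, rfl⟩)
    (by
      rintro _ ⟨t, ht, rfl⟩
      rw [charTwist_charTwist hpN hχ hprim (hT t ht)]
      exact Submodule.subset_span ht)

/-- **BLOCK-TWIN for a newform**: a newform `f` of level `N` with `p² ∣ N` is `p`-depleted
(`a_p(f) = 0`, [AtkinLehner1970] Thm. 3; o5's `cuspCoeff_eq_zero_of_prime_dvd_of_isNewform0`), so
`natCard_blockQuotient_charTwist` applies to it for every exchanged pair `(X, X′)`.
[cite: AgasheRibetStein2012, §2.1] [cite: AtkinLehner1970, Thm. 3] -/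
theorem natCard_blockQuotient_charTwist_of_isNewform0 (hprim : χ.IsPrimitive)
    {f : CuspForm (Gamma0 N) k} (hf : IsNewform0 f) {X X' : Submodule ℂ (CuspForm (Gamma0 N) k)}
    (hX : ∀ x ∈ X, charTwist N dvd_rfl hpN hχ x ∈ X')
    (hX' : ∀ x ∈ X', charTwist N dvd_rfl hpN hχ x ∈ X) :
    Nat.card (↥(integralCuspForms0 N k ⊓ ((ℂ ∙ f) ⊔ X).restrictScalars ℤ) ⧸
        ((ℤ ∙ f) ⊔ (integralCuspForms0 N k ⊓ X.restrictScalars ℤ)).comap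
          (integralCuspForms0 N k ⊓ ((ℂ ∙ f) ⊔ X).restrictScalars ℤ).subtype) =
      Nat.card (↥(integralCuspForms0 N k ⊓
            ((ℂ ∙ charTwist N dvd_rfl hpN hχ f) ⊔ X').restrictScalars ℤ) ⧸
        ((ℤ ∙ charTwist N dvd_rfl hpN hχ f) ⊔
            (integralCuspForms0 N k ⊓ X'.restrictScalars ℤ)).comap
          (integralCuspForms0 N k ⊓
            ((ℂ ∙ charTwist N dvd_rfl hpN hχ f) ⊔ X').restrictScalars ℤ).subtype) :=
  natCard_blockQuotient_charTwist hpN hχ hprim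
    (fun _ hn ↦ cuspCoeff_eq_zero_of_prime_dvd_of_isNewform0 hpN hf hn) hX hX'


end PrimeTwist

end Summit.BirchSwinnertonDyer.Rank1Residual.O5
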